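import Summits.HodgeConjecture.HodgeConjecture.Theorems.F0P3cStCharTSHbOnMc       -- ★ (LH6-p04 g4) p850861 «HB-ON-MC★» — brings ★ «VDW-CORE» (A6) `F0P3cStCharTSVanDijkHC.norm_ofReal_vanDijkWeight_re_mul_le_of_hcBound`, `torusChart`, `vanDijkWeight`, ★ `isCompact_torusCompactPart`, ★ `continuous_torusChart`
import Literature.NumberTheory.Rogawski1990.Ch12Sec5                                 -- ★ TR carpet: `EllipticData.UpSpec` (the definition of `α ↦ α^G`, p. 183; used for `Measurable (𝔇.up χ_ρ)` only), `IsStableClassFunOn`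
import Literature.NumberTheory.Rogawski1990.Ch12Sec5Inputs                           -- ★ TR carpet (sockets): (M1H) `PacketCharHRegularity`, (U2) `L2UpOnTorus`
import Literature.NumberTheory.Rogawski1990.Ch12Sec5UpSpecLB                         -- ★ p852414 (F0P3-p02 g23): `EllipticData.UpSpecLB` — the locally-bounded reading of `UpSpec` (ED. 2, the `_LB` twin of §3)
import Mathlib.MeasureTheory.Function.LpSeminorm.CompareExp
import HarnessLib

/-!
# F0 · P3c · line LH6 «StCharTS» — «U2∕HCB-UP-OF-UPDOM★» (datum road S13a, hypothesis form, shape (B)): the two `up`-BOUNDS of the (S-𝔇) organ — (U2) `L2UpOnTorus`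
# («`D_G·χ_ρ^G ∈ L²(T, dγ)` on every elliptic Cartan representative») and (HCB-up) («`|D_G·χ_ρ^G| ≤ B` on `M_c`, `ρ = {St_H(ξ_v)}`») — from the DOMINATION that Lemma 12.5.1
# gives («`D_G(x)|χ_ρ^G(x)| ≤ Σ_{s ↦ x} D_H(s)|χ_ρ(s)|`», at most three matched `H`-classes) and Harish-Chandra's bound on `H` [Rogawski1990, §12.5 p. 183; L. 12.7.2 proof p. 193; §1.6 p. 6]

Cell `pub/hodgecm-mathlib`, crux H413 = `stmt-HodgeConjecture-24833` (lane `--supports … --as helper`), route HCCMUnconditional; seat F0P3-p02 (g20); slice S13a of the (S-𝔇)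
DATUM ROAD (map owner LH6-p01 (g4), `F0/P3b/LH6-p01/g4/MAP-DATUM-ROAD.v3.LH6p01g4.md` row S13 «UP»; slice word 2026-09-02T11:49:03Z), in the SHAPE (B) of LH4-p01 (g5)'s
S13-CENSUS (`F0/P3c/LH4/LH4-p01/g5/S13-CENSUS.v1.LH4p01g5.md` §5): this file consumes the derived domination (UP-DOM) and the `H`-side Harish-Chandra bound, never the §12.5 bookkeeping
fields (`cartanHG`, `dTF`, `twist`, `kappa`, `cosetReps`, `wAct`, `tau`), which no conjunct of the organ reads.  THEOREMS ONLY (no definition ∕ instance ∕ notation ∕ named fact ∕ `sorry`);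
★-only imports; §1–§3 GENERIC over the carriers `G ⊇ H` of ★ `Ch12Sec5Defs.EllipticData`, §4–§5 on `G = U(Φ₃)(L⁺_v)` with `H` abstract; the `H`-regularity predicate `P` (the pen
instantiates `P := IsLocalGRegular L v`) and the matching count `n` (`:= 3`) are PARAMETERS.
HONEST LABEL: HC_CM is proved only modulo the 7 printed citations (2 remaining named inputs: hLiu418 = `stmt-HodgeConjecture-24832`, h413 = `stmt-HodgeConjecture-24833`)
until rung 0 closes; this file closes no organ — at the future concrete datum the sockets (U2) and (HCB-up) of `stub_EllipticPackage` (`Cruxes/H413/Lines/F0_P3c_StCharTSPaydown.lean`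
ED. 17 :262, :301–302) become theorems MODULO (UP-DOM) (slice S13c «UP-DOM ⟸ UP-DEF», the transfer-factor form of L. 12.5.1) and the `H`-side Harish-Chandra bound — count-neutral.

THE MATHEMATICS ([Rogawski1990, L. 12.7.2 proof p. 193]: «Since `χ_ρ^G` has bounded elliptic norm …»; the leaf's gloss of (HCB-up): «L. 12.5.1 p. 183 at `T = M` + Harish-Chandra
Thm. 16.3 on `H`»).  LEMMA 12.5.1 [§12.5 p. 183] computes `D_G(γ)·α^G(γ^δ)` for `γ` regular in a Cartan subgroup `T ⊂ H` as a sum of at most `|Ω_F(T,G)|∕|Ω_F(T,H)| ≤ 3` terms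
`τ(s)·D_H(s)·κ·α(s)` over `H`-elements `s` matched with `γ^δ`, with `|τ| = 1` (`μ` unitary, §4.9 p. 55) and `κ = ±1`; `α^G` vanishes at regular points of type-(3) tori (§3.6) and,
as a function, may be taken `0` off `G^r` (a null set).  Hence the DOMINATION (UP-DOM): for a stable class function `α` on `H^r` and a compact `K ⊆ G` there is a compact `C ⊆ H` with,
for `x ∈ K`: `α^G(x) = 0` if `x ∉ G^r`, and `|D_G(x)·α^G(x)| ≤ Σ_{s ∈ S} |D_H(s)·α(s)|` for some `S ⊆ C` of at most `n` `G`-regular elements if `x ∈ G^r`.  With HARISH-CHANDRA ON `H`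
[§1.6 p. 6; HC Thm. 16.3] in compact-set shape — «`|D_H(s)·χ_ρ(s)| ≤ B_C` for `G`-regular `s` in the compact `C`» — one gets `|D_G·χ_ρ^G| ≤ n·B_C` on ALL of `K`.  (U2): `K := T'` an
elliptic (compact) representative of finite mass ⇒ `D_G·χ_ρ^G|_{T'}` is bounded measurable on a finite measure space, hence in `L²(T', dγ)` (Mathlib `MemLp.of_bound`).  (HCB-up):
`K := ι(M_c)` (compact, ★ `isCompact_torusCompactPart`); with the D5 junction «`D_G(g) = √√‖u‖` whenever `u·det(g)² = discr(charpoly g)`» (print's `D_G = |D_G|^{1∕2}`, §4.9 p. 54) the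
bound takes the SHAPE of ★ `normalizedCharacter_locallyBounded`'s conclusion for `Θ := χ_ρ^G`, and ★ VDW-CORE (A6) `norm_ofReal_vanDijkWeight_re_mul_le_of_hcBound` turns it into
`‖Re Δ(ι m)·χ_ρ^G(ι m)‖ ≤ B` for every `m ∈ M_c` (`√√‖u‖ = Re Δ(t)` at regular `t`, `Δ(t) = 0` otherwise).
* §1 `memLp_two_of_bound` — one torus: a pointwise bound on a finite measure space gives `L²`;
* §2 `norm_mul_up_le_of_upDom` — (UP-DOM) on `K` + the `H`-bound on its `C` ⇒ `‖D_G(x)·χ_ρ^G(x)‖ ≤ n · max B 0` for every `x ∈ K`;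
* §3 `l2UpOnTorus_of_upDom` — (U2) ★ `EllipticData.L2UpOnTorus` (leaf ED. 17 :262 BY NAME), GENERIC carriers;
* §4 `hcShape_up_of_upDom` — on `U(Φ₃)(L⁺_v)`: the Harish-Chandra SHAPE for `χ_ρ^G` on a compact set of torus points from (UP-DOM) + the D5 junction (no regularity case split:
  (UP-DOM)'s «`α^G = 0` off `G^r`» clause covers the singular points);
* §5 `hcbUp_of_upDom` — the (HCB-up) conjunct of the organ (leaf ED. 17 :301–302) VERBATIM for `ρ = {πSt}`.
AT THE CONSTRUCTOR (PLAN S9 + S13-CENSUS §5–§6): (UP-DOM) = slice S13c from the field equation (UP-DEF) «`up α` := L. 12.5.1 in transfer-factor form, `0` off `G^r`» (★ `finTau`,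
★ `finKappaAt`, ★ `IsLocalNormPair`, ★ stable invariance); the `H`-bound = ★ `normalizedCharacter_locallyBounded` at `N = 2, 1` once S12 pins `charH`∕`DH`; compact elliptic
representatives and finite `μT` = D3∕D4 (★ S9a∕S9c hypotheses verbatim); the D5 junction = D5's definition `D_G := √√‖discr∕det²‖`.

## References
* [Rogawski1990] J. D. Rogawski, *Automorphic Representations of Unitary Groups in Three Variables*, Ann. of Math. Stud. 123 (1990): §1.6 p. 6 ([H₁]); §3.6 pp. 28–31
  (types of Cartan subgroups; type (3) not in `H`); §4.9 pp. 54–55 (`D_G`, `D_H`, `τ`, `κ`); §12.5 p. 183 (`α^G`, LEMMA 12.5.1), p. 184 (elliptic representatives, `meas(Z∖T) = 1`);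
  §12.7 Lemma 12.7.2 (proof) p. 193 («`χ_ρ^G` has bounded elliptic norm»; the `M_c` bound).
* [HarishChandra1999AdmissibleDistributions] Harish-Chandra (notes by S. DeBacker, P. J. Sally), *Admissible invariant distributions on reductive p-adic groups*, AMS ULS 16 (1999):
  Part III §16 Thm. 16.3.
-/

set_option autoImplicit false
-- the mandated namespace has the single-problem summit's repeated segment (`HodgeConjecture.HodgeConjecture`)
set_option linter.dupNamespace false

noncomputable section

open MeasureTheory Filter Topology
open NumberField IsDedekindDomain
open scoped NNReal Matrix MatrixGroups
open Literature.NumberTheory.Automorphic Literature.NumberTheory.Automorphic.UnitaryGroup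
open Literature.NumberTheory.Rogawski1990 Literature.NumberTheory.Rogawski1990.Ch12Sec5

namespace Summit.HodgeConjecture.HodgeConjecture.Cruxes.H413.F0P3cStCharTSU2OfUpDom

/-! ## §1 One torus: a pointwise bound on a finite measure space gives `L²` -/

section OneTorus

variable {G : Type} [Group G] [MeasurableSpace G]

/-- **One-torus measure step.**  On a subgroup `T' ≤ G` with a FINITE measure `μ` on `↥T'`, if `D : G → ℝ` and `U : G → ℂ` are measurable and `‖D(t)·U(t)‖ ≤ C` for every
`t ∈ T'`, then `t ↦ D(t)·U(t)` is in `L²(T', μ)` (Mathlib `MemLp.of_bound`). [cite: Rogawski1990, §12.5 p. 184; §12.7 Lemma 12.7.2 (proof) p. 193] -/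
theorem memLp_two_of_bound (T' : Subgroup G) (μ : Measure ↥T') [IsFiniteMeasure μ]
    {D : G → ℝ} (hDm : Measurable D) {U : G → ℂ} (hUm : Measurable U) {C : ℝ}
    (hC : ∀ t : ↥T', ‖(D (t : G) : ℂ) * U (t : G)‖ ≤ C) :
    MemLp (fun t : ↥T' => (D (t : G) : ℂ) * U (t : G)) 2 μ :=
  MemLp.of_bound
    ((Complex.measurable_ofReal.comp (hDm.comp measurable_subtype_coe)).mul (hUm.comp measurable_subtype_coe)).aestronglyMeasurable
    C (Eventually.of_forall hC)

end OneTorus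

/-! ## §2 (UP-DOM) on a compact `K` + Harish-Chandra on `H` over the matched compact `C` ⇒ `‖D_G·χ_ρ^G‖ ≤ n·B` on `K` -/

section Generic

variable {G H : Type} [Group G] [TopologicalSpace G] [IsTopologicalGroup G] [MeasurableSpace G]
  [∀ γ : G, MeasurableSpace (G ⧸ Subgroup.centralizer ({γ} : Set G))] [MeasurableSpace (G ⧸ Subgroup.center G)]
  [Group H] [TopologicalSpace H] [IsTopologicalGroup H] [MeasurableSpace H]

/-- **The pointwise bound on a compact `K ⊆ G`.**  For a §12.5 datum `𝔇`, a regularity predicate `P` on `H`, a count `n`, a function `α` on `H` satisfying the DOMINATION (UP-DOM) at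
`K` («`C ⊆ H` compact; `x ∉ G^r ⇒ α^G(x) = 0`; `x ∈ G^r ⇒ |D_G(x)·α^G(x)| ≤ Σ_{s ∈ S} |D_H(s)·α(s)|` for some `S ⊆ C`, `#S ≤ n`, all `P`») and the `H`-side bound «`|D_H(s)·α(s)| ≤ B`
for `s ∈ C` with `P s`»: `‖D_G(x)·α^G(x)‖ ≤ n · max B 0` for every `x ∈ K`. [cite: Rogawski1990, §12.5 Lemma 12.5.1 p. 183; §1.6 p. 6] -/
theorem norm_mul_up_le_of_upDom (𝔇 : EllipticData G H) (P : H → Prop) (n : ℕ) (α : H → ℂ) (K : Set G) (C : Set H)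
    (hdom : ∀ x ∈ K, (x ∉ 𝔇.regG → 𝔇.up α x = 0) ∧
      (x ∈ 𝔇.regG → ∃ S : Finset H, S.card ≤ n ∧ (↑S : Set H) ⊆ C ∧ (∀ s ∈ S, P s) ∧
        ‖(𝔇.DG x : ℂ) * 𝔇.up α x‖ ≤ ∑ s ∈ S, ‖(𝔇.DH s : ℂ) * α s‖))
    {B : ℝ} (hB : ∀ s ∈ C, P s → ‖(𝔇.DH s : ℂ) * α s‖ ≤ B) :
    ∀ x ∈ K, ‖(𝔇.DG x : ℂ) * 𝔇.up α x‖ ≤ n * max B 0 := by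
  intro x hx
  have hnB : 0 ≤ (n : ℝ) * max B 0 := mul_nonneg (Nat.cast_nonneg n) (le_max_right B 0)
  by_cases hxr : x ∈ 𝔇.regG
  · obtain ⟨S, hSn, hSC, hSP, hle⟩ := (hdom x hx).2 hxr
    calc ‖(𝔇.DG x : ℂ) * 𝔇.up α x‖ ≤ ∑ s ∈ S, ‖(𝔇.DH s : ℂ) * α s‖ := hle
      _ ≤ ∑ _s ∈ S, max B 0 := Finset.sum_le_sum fun s hs => (hB s (hSC (Finset.mem_coe.2 hs)) (hSP s hs)).trans (le_max_left B 0)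
      _ = S.card * max B 0 := by rw [Finset.sum_const, nsmul_eq_mul]
      _ ≤ n * max B 0 := by gcongr
  · rw [(hdom x hx).1 hxr, mul_zero, norm_zero]
    exact hnB

/-! ## §3 The slice, first half: (U2) `L2UpOnTorus` from (UP-DOM) + Harish-Chandra on `H`, at a datum with compact elliptic representatives of finite mass -/

/-- **S13a (B) — the socket (U2) ★ `EllipticData.L2UpOnTorus` from the DOMINATION (UP-DOM) and Harish-Chandra's bound on `H`.**  For a §12.5 datum `𝔇` on carriers `G ⊇ H`, a
regularity predicate `P : H → Prop` (the pen's `IsLocalGRegular L v`) and a count `n` (`3`): GIVEN the carpet ★ `UpSpec` [p. 183 — used only for `Measurable (χ_ρ^G)`] and the socket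
(M1H) ★ `PacketCharHRegularity` (measurability and stability of `χ_ρ` on `H^r`); the SLICE HYPOTHESES «`DG` measurable; every `T' ∈ cartanG` compact in `G` with `μT T'` finite» (PLAN S9
D3∕D4, the hypotheses of ★ S9c verbatim); the DOMINATION `hUpDom` (for every stable class function `α` on `H^r` and compact `K ⊆ G`, a compact `C ⊆ H` with, on `K`: `α^G = 0` off `G^r`,
and `‖D_G·α^G‖ ≤ Σ_{s∈S} ‖D_H·α‖(s)` for some `S ⊆ C`, `#S ≤ n`, all `P`, on `G^r` — Lemma 12.5.1 in transfer-factor form, slice S13c); and HARISH-CHANDRA ON `H` `hHBH` (on every compact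
`C ⊆ H` a bound `‖D_H(s)·χ_ρ(s)‖ ≤ B` at the `P`-regular `s`) — (U2) holds: `D_G·χ_ρ^G ∈ L²(T', dγ)` for every `ρ ∈ Π²(H)` and `T' ∈ cartanG`.
[cite: Rogawski1990, §12.5 Lemma 12.5.1 p. 183, p. 184; §12.7 Lemma 12.7.2 (proof) p. 193; §1.6 p. 6] [cite: HarishChandra1999AdmissibleDistributions, Part III §16 Thm. 16.3] -/
theorem l2UpOnTorus_of_upDom (𝔇 : EllipticData G H) (P : H → Prop) (n : ℕ)
    (hUp : 𝔇.UpSpec) (hM1H : 𝔇.PacketCharHRegularity)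
    (hDGm : Measurable 𝔇.DG)
    (hK : ∀ T' ∈ 𝔇.cartanG, IsCompact (T' : Set G))
    (hF : ∀ T' ∈ 𝔇.cartanG, IsFiniteMeasure (𝔇.μT T'))
    (hUpDom : ∀ α : H → ℂ, IsStableClassFunOn 𝔇.stConjH 𝔇.regH α →
      ∀ K : Set G, IsCompact K → ∃ C : Set H, IsCompact C ∧
        ∀ x ∈ K, (x ∉ 𝔇.regG → 𝔇.up α x = 0) ∧
          (x ∈ 𝔇.regG → ∃ S : Finset H, S.card ≤ n ∧ (↑S : Set H) ⊆ C ∧ (∀ s ∈ S, P s) ∧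
            ‖(𝔇.DG x : ℂ) * 𝔇.up α x‖ ≤ ∑ s ∈ S, ‖(𝔇.DH s : ℂ) * α s‖))
    (hHBH : ∀ ρ ∈ 𝔇.sqPacketsH, ∀ C : Set H, IsCompact C →
      ∃ B : ℝ, ∀ s ∈ C, P s → ‖(𝔇.DH s : ℂ) * 𝔇.packetCharH ρ s‖ ≤ B) :
    𝔇.L2UpOnTorus := by
  intro ρ hρ T' hT'
  obtain ⟨hαm, -, hαst, -, -⟩ := hM1H ρ hρ
  obtain ⟨hUm, -, -⟩ := hUp (𝔇.packetCharH ρ) hαm hαst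
  haveI := hF T' hT'
  obtain ⟨C, hCc, hdom⟩ := hUpDom (𝔇.packetCharH ρ) hαst (T' : Set G) (hK T' hT')
  obtain ⟨B, hB⟩ := hHBH ρ hρ C hCc
  exact memLp_two_of_bound T' (𝔇.μT T') hDGm hUm fun t =>
    norm_mul_up_le_of_upDom 𝔇 P n (𝔇.packetCharH ρ) (T' : Set G) C hdom hB (t : G) t.2

end Generic

/-! ## §4 On `U(Φ₃)(L⁺_v)`: the Harish-Chandra SHAPE «`√√‖u‖·‖χ_ρ^G(g)‖ ≤ B` on a compact set of torus points» from (UP-DOM) + the D5 junction -/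

section Gqs

open F0P3cStCharTSTorusDefs

variable (L : Type) [Field L] [NumberField L] [IsCMField L] (v : HeightOneSpectrum (𝓞 ↥(maximalRealSubfield L)))

/-- **§4 — the Harish-Chandra SHAPE for `χ_ρ^G = 𝔇.up (χ_ρ)` on a COMPACT set `C` of split-torus points, from (UP-DOM).**  For a §12.5 datum `𝔇` on `G = U(Φ₃)(L⁺_v)` (abstract `H`,
predicate `P`, count `n`) with (M1H), the domination `hUpDom`, the `H`-bound `hHBH`, and the D5 JUNCTION on `C` («`𝔇.DG g = √√‖u‖` whenever `u·det(g)² =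
discr(charpoly g)`», print's `D_G = |D_G|^{1∕2}` [§4.9 p. 54]), where `C` is a compact set of torus points `ι t`: there is `B` with `√√‖u‖·‖χ_ρ^G(g)‖ ≤ B` for all `g ∈ C` and all units
`u` with `u·det(g)² = discr(charpoly g)` — the conclusion SHAPE of ★ `normalizedCharacter_locallyBounded` at `N = 3` for the (non-irreducible) class function `χ_ρ^G` (the antecedent
is not even needed for regularity: §2 bounds `‖D_G·χ_ρ^G‖` at every point of the compact set). [cite: Rogawski1990, §12.5 Lemma 12.5.1 p. 183; §4.9 pp. 54–55; §1.6 p. 6] -/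
theorem hcShape_up_of_upDom
    [MeasurableSpace (Gqs L v)]
    [∀ γ : Gqs L v, MeasurableSpace (Gqs L v ⧸ Subgroup.centralizer ({γ} : Set (Gqs L v)))] [MeasurableSpace (Gqs L v ⧸ Subgroup.center (Gqs L v))]
    {H : Type} [Group H] [TopologicalSpace H] [IsTopologicalGroup H] [MeasurableSpace H]
    (𝔇 : EllipticData (Gqs L v) H) (P : H → Prop) (n : ℕ) (hM1H : 𝔇.PacketCharHRegularity)
    (hUpDom : ∀ α : H → ℂ, IsStableClassFunOn 𝔇.stConjH 𝔇.regH α →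
      ∀ K : Set (Gqs L v), IsCompact K → ∃ C : Set H, IsCompact C ∧
        ∀ x ∈ K, (x ∉ 𝔇.regG → 𝔇.up α x = 0) ∧
          (x ∈ 𝔇.regG → ∃ S : Finset H, S.card ≤ n ∧ (↑S : Set H) ⊆ C ∧ (∀ s ∈ S, P s) ∧
            ‖(𝔇.DG x : ℂ) * 𝔇.up α x‖ ≤ ∑ s ∈ S, ‖(𝔇.DH s : ℂ) * α s‖))
    (hHBH : ∀ ρ ∈ 𝔇.sqPacketsH, ∀ C : Set H, IsCompact C →
      ∃ B : ℝ, ∀ s ∈ C, P s → ‖(𝔇.DH s : ℂ) * 𝔇.packetCharH ρ s‖ ≤ B)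
    (ρ : Finset (IrrClass H)) (hρ : ρ ∈ 𝔇.sqPacketsH)
    (C : Set ↥(cmBorelTriple L 3 v).M)
    (hC : IsCompact ((fun t : ↥(cmBorelTriple L 3 v).M => ((t : ↥(unitaryGroupOfForm (conjLocal L (IsCMField.complexConj L) v) (cmLocalForm L 3 v))) : Gqs L v)) '' C))
    (hD5 : ∀ t ∈ C, ∀ u : (UnitaryGroup.LocalRing L v)ˣ,
      (u : UnitaryGroup.LocalRing L v) *
          ((((t : ↥(unitaryGroupOfForm (conjLocal L (IsCMField.complexConj L) v) (cmLocalForm L 3 v))) : Gqs L v).val : GL (Fin 3) (UnitaryGroup.LocalRing L v)).val.det) ^ (3 - 1) =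
        ((((t : ↥(unitaryGroupOfForm (conjLocal L (IsCMField.complexConj L) v) (cmLocalForm L 3 v))) : Gqs L v).val : GL (Fin 3) (UnitaryGroup.LocalRing L v)).val.charpoly).discr →
      𝔇.DG ((t : ↥(unitaryGroupOfForm (conjLocal L (IsCMField.complexConj L) v) (cmLocalForm L 3 v))) : Gqs L v) =
        ((NNReal.sqrt (NNReal.sqrt (unitModulusChar (UnitaryGroup.LocalRing L v) u)) : ℝ≥0) : ℝ)) :
    ∃ B : ℝ, ∀ g ∈ ((fun t : ↥(cmBorelTriple L 3 v).M => ((t : ↥(unitaryGroupOfForm (conjLocal L (IsCMField.complexConj L) v) (cmLocalForm L 3 v))) : Gqs L v)) '' C),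
      ∀ u : (UnitaryGroup.LocalRing L v)ˣ,
      (u : UnitaryGroup.LocalRing L v) * ((g.val : GL (Fin 3) (UnitaryGroup.LocalRing L v)).val.det) ^ (3 - 1) =
          ((g.val : GL (Fin 3) (UnitaryGroup.LocalRing L v)).val.charpoly).discr →
        ((NNReal.sqrt (NNReal.sqrt (unitModulusChar (UnitaryGroup.LocalRing L v) u)) : ℝ≥0) : ℝ) * ‖𝔇.up (𝔇.packetCharH ρ) g‖ ≤ B := by
  obtain ⟨-, -, hαst, -, -⟩ := hM1H ρ hρ
  obtain ⟨CH, hCHc, hdom⟩ := hUpDom (𝔇.packetCharH ρ) hαst _ hC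
  obtain ⟨B, hB⟩ := hHBH ρ hρ CH hCHc
  refine ⟨n * max B 0, ?_⟩
  rintro g ⟨t, ht, rfl⟩ u hu
  have hbd := norm_mul_up_le_of_upDom 𝔇 P n (𝔇.packetCharH ρ) _ CH hdom hB _ (Set.mem_image_of_mem _ ht)
  have hDG := hD5 t ht u hu
  have hnn : 0 ≤ 𝔇.DG ((t : ↥(unitaryGroupOfForm (conjLocal L (IsCMField.complexConj L) v) (cmLocalForm L 3 v))) : Gqs L v) := by
    rw [hDG]; exact NNReal.coe_nonneg _
  rw [norm_mul, Complex.norm_real, Real.norm_eq_abs, abs_of_nonneg hnn, hDG] at hbd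
  exact hbd

/-! ## §5 (HCB-up) verbatim: `‖Re Δ(ι m) · χ_ρ^G(ι m)‖ ≤ B` on `M_c`, `ρ = {St_H(ξ_v)}` — (UP-DOM) at `K = ι(M_c)` + Harish-Chandra on `H` + the junction `√√‖u‖ = Re Δ` (★ VDW-CORE) -/

/-- **S13a (B) — the (HCB-up) conjunct of (S-𝔇) (leaf ED. 17 :301–302) VERBATIM, from (UP-DOM)** («L. 12.5.1 p. 183 at `T = M` + Harish-Chandra Thm. 16.3 on `H`», the leaf's own gloss of
the socket).  `v` NON-SPLIT; `𝔇` a §12.5 datum on `U(Φ₃)(L⁺_v)` (abstract `H`, predicate `P`, count `n`) with (M1H), the domination `hUpDom`, the `H`-bound `hHBH`, `{πSt} ∈ Π²(H)`, and the D5 junction on the split torus «`𝔇.DG (ι t) = √√‖u‖` whenever `u·det(ι t)² = discr(charpoly (ι t))`».  THEN `∃ B, ∀ m ∈ M_c = 𝒪_vˣ × E¹_v,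
‖Re Δ(torusChart m) · χ_ρ^G(ι(torusChart m))‖ ≤ B` — §4 on the compact `ι(torusChart(M_c))` (★ `isCompact_torusCompactPart`, ★ `continuous_torusChart`) and ★ VDW-CORE (A6)
(`√√‖u‖ = Re Δ(t)` at regular `t`, `Δ(t) = 0` otherwise).
[cite: Rogawski1990, §12.5 Lemma 12.5.1 p. 183; §12.7 Lemma 12.7.2 (proof) p. 193; §4.9 p. 54; §1.6 p. 6] [cite: HarishChandra1999AdmissibleDistributions, Part III §16 Thm. 16.3] -/
theorem hcbUp_of_upDom (hns : ∀ w : PlacesOver L v, IsCMField.complexConj L • w.1 = w.1)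
    [MeasurableSpace (Gqs L v)]
    [∀ γ : Gqs L v, MeasurableSpace (Gqs L v ⧸ Subgroup.centralizer ({γ} : Set (Gqs L v)))] [MeasurableSpace (Gqs L v ⧸ Subgroup.center (Gqs L v))]
    {H : Type} [Group H] [TopologicalSpace H] [IsTopologicalGroup H] [MeasurableSpace H]
    (𝔇 : EllipticData (Gqs L v) H) (P : H → Prop) (n : ℕ) (hM1H : 𝔇.PacketCharHRegularity)
    (hUpDom : ∀ α : H → ℂ, IsStableClassFunOn 𝔇.stConjH 𝔇.regH α →
      ∀ K : Set (Gqs L v), IsCompact K → ∃ C : Set H, IsCompact C ∧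
        ∀ x ∈ K, (x ∉ 𝔇.regG → 𝔇.up α x = 0) ∧
          (x ∈ 𝔇.regG → ∃ S : Finset H, S.card ≤ n ∧ (↑S : Set H) ⊆ C ∧ (∀ s ∈ S, P s) ∧
            ‖(𝔇.DG x : ℂ) * 𝔇.up α x‖ ≤ ∑ s ∈ S, ‖(𝔇.DH s : ℂ) * α s‖))
    (hHBH : ∀ ρ ∈ 𝔇.sqPacketsH, ∀ C : Set H, IsCompact C →
      ∃ B : ℝ, ∀ s ∈ C, P s → ‖(𝔇.DH s : ℂ) * 𝔇.packetCharH ρ s‖ ≤ B)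
    (πSt : IrrClass H) (hρ : ({πSt} : Finset (IrrClass H)) ∈ 𝔇.sqPacketsH)
    (hD5 : ∀ (t : ↥(cmBorelTriple L 3 v).M) (u : (UnitaryGroup.LocalRing L v)ˣ),
      (u : UnitaryGroup.LocalRing L v) *
          ((((t : ↥(unitaryGroupOfForm (conjLocal L (IsCMField.complexConj L) v) (cmLocalForm L 3 v))) : Gqs L v).val : GL (Fin 3) (UnitaryGroup.LocalRing L v)).val.det) ^ (3 - 1) =
        ((((t : ↥(unitaryGroupOfForm (conjLocal L (IsCMField.complexConj L) v) (cmLocalForm L 3 v))) : Gqs L v).val : GL (Fin 3) (UnitaryGroup.LocalRing L v)).val.charpoly).discr →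
      𝔇.DG ((t : ↥(unitaryGroupOfForm (conjLocal L (IsCMField.complexConj L) v) (cmLocalForm L 3 v))) : Gqs L v) =
        ((NNReal.sqrt (NNReal.sqrt (unitModulusChar (UnitaryGroup.LocalRing L v) u)) : ℝ≥0) : ℝ)) :
    ∃ B : ℝ, ∀ m : ((UnitaryGroup.LocalRing L v)ˣ × ↥(normOneUnits (conjLocal L (IsCMField.complexConj L) v))),
      m ∈ (((Submonoid.pi Set.univ (fun w : PlacesOver L v => (w.1.adicCompletionIntegers L).toSubring.toSubmonoid)).units.prod (⊤ : Subgroup ↥(normOneUnits (conjLocal L (IsCMField.complexConj L) v)))) : Subgroup ((UnitaryGroup.LocalRing L v)ˣ × ↥(normOneUnits (conjLocal L (IsCMField.complexConj L) v)))) →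
        ‖(((vanDijkWeight L v (torusChart L v m)).re : ℝ) : ℂ) * 𝔇.up (𝔇.packetCharH {πSt}) (((torusChart L v m : ↥(cmBorelTriple L 3 v).M) : ↥(unitaryGroupOfForm (conjLocal L (IsCMField.complexConj L) v) (cmLocalForm L 3 v))) : Gqs L v)‖ ≤ B := by
  -- `C := torusChart(M_c) ⊆ M`, a compact set of torus points (`ι` continuous)
  set Mc : Set (((UnitaryGroup.LocalRing L v)ˣ × ↥(normOneUnits (conjLocal L (IsCMField.complexConj L) v)))) :=
    ((((Submonoid.pi Set.univ (fun w : PlacesOver L v => (w.1.adicCompletionIntegers L).toSubring.toSubmonoid)).units.prod (⊤ : Subgroup ↥(normOneUnits (conjLocal L (IsCMField.complexConj L) v)))) : Subgroup ((UnitaryGroup.LocalRing L v)ˣ × ↥(normOneUnits (conjLocal L (IsCMField.complexConj L) v)))) :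
      Set ((UnitaryGroup.LocalRing L v)ˣ × ↥(normOneUnits (conjLocal L (IsCMField.complexConj L) v)))) with hMcdef
  set C : Set ↥(cmBorelTriple L 3 v).M := torusChart L v '' Mc with hCdef
  have hι : Continuous fun t : ↥(cmBorelTriple L 3 v).M => ((t : ↥(unitaryGroupOfForm (conjLocal L (IsCMField.complexConj L) v) (cmLocalForm L 3 v))) : Gqs L v) :=
    continuous_subtype_val
  have hCc : IsCompact ((fun t : ↥(cmBorelTriple L 3 v).M => ((t : ↥(unitaryGroupOfForm (conjLocal L (IsCMField.complexConj L) v) (cmLocalForm L 3 v))) : Gqs L v)) '' C) :=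
    (((F0P3cStCharTSTorusCompactPart.isCompact_torusCompactPart L v hns).image (F0P3cStCharTSTorusChartIso.continuous_torusChart L v)).image hι)
  obtain ⟨B, hB⟩ := hcShape_up_of_upDom L v 𝔇 P n hM1H hUpDom hHBH {πSt} hρ C hCc (fun t _ u hu => hD5 t u hu)
  refine ⟨max B 0, fun m hm => F0P3cStCharTSVanDijkHC.norm_ofReal_vanDijkWeight_re_mul_le_of_hcBound L v hns hB (torusChart L v m) ?_⟩
  exact Set.mem_image_of_mem _ (Set.mem_image_of_mem _ hm)

end Gqs

/-! ## §6 (ED. 2) The `_LB` twin of §3 — the socket (U2) from the LOCALLY-BOUNDED carpet reading ★ `UpSpecLB` (ROAD «UP-TR» DEAL #4 (D4-6); guard γ: §3 untouched) -/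

section GenericLB

variable {G H : Type} [Group G] [TopologicalSpace G] [IsTopologicalGroup G] [MeasurableSpace G]
  [∀ γ : G, MeasurableSpace (G ⧸ Subgroup.centralizer ({γ} : Set G))] [MeasurableSpace (G ⧸ Subgroup.center G)]
  [Group H] [TopologicalSpace H] [IsTopologicalGroup H] [MeasurableSpace H]

/-- **S13a (B), `_LB` twin — the socket (U2) ★ `EllipticData.L2UpOnTorus` from (UP-DOM) + Harish-Chandra on `H`, with the carpet hypothesis weakened to ★ `UpSpecLB`**
(the locally-bounded reading of p. 183, ★ p852414).  Statement = ★ `l2UpOnTorus_of_upDom` token for token except `hUp : 𝔇.UpSpecLB`; the proof consumes only clause 1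
(`Measurable (χ_ρ^G)`), which `UpSpecLB` carries unconditionally, so the body is ★ §3's by paste (pass-through twin; no local-boundedness binder is needed here).
[cite: Rogawski1990, §12.5 Lemma 12.5.1 p. 183, p. 184; §12.7 Lemma 12.7.2 (proof) p. 193; §1.6 p. 6] [cite: HarishChandra1999AdmissibleDistributions, Part III §16 Thm. 16.3] -/
theorem l2UpOnTorus_of_upDom_LB (𝔇 : EllipticData G H) (P : H → Prop) (n : ℕ)
    (hUp : 𝔇.UpSpecLB) (hM1H : 𝔇.PacketCharHRegularity)
    (hDGm : Measurable 𝔇.DG)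
    (hK : ∀ T' ∈ 𝔇.cartanG, IsCompact (T' : Set G))
    (hF : ∀ T' ∈ 𝔇.cartanG, IsFiniteMeasure (𝔇.μT T'))
    (hUpDom : ∀ α : H → ℂ, IsStableClassFunOn 𝔇.stConjH 𝔇.regH α →
      ∀ K : Set G, IsCompact K → ∃ C : Set H, IsCompact C ∧
        ∀ x ∈ K, (x ∉ 𝔇.regG → 𝔇.up α x = 0) ∧
          (x ∈ 𝔇.regG → ∃ S : Finset H, S.card ≤ n ∧ (↑S : Set H) ⊆ C ∧ (∀ s ∈ S, P s) ∧
            ‖(𝔇.DG x : ℂ) * 𝔇.up α x‖ ≤ ∑ s ∈ S, ‖(𝔇.DH s : ℂ) * α s‖))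
    (hHBH : ∀ ρ ∈ 𝔇.sqPacketsH, ∀ C : Set H, IsCompact C →
      ∃ B : ℝ, ∀ s ∈ C, P s → ‖(𝔇.DH s : ℂ) * 𝔇.packetCharH ρ s‖ ≤ B) :
    𝔇.L2UpOnTorus := by
  intro ρ hρ T' hT'
  obtain ⟨hαm, -, hαst, -, -⟩ := hM1H ρ hρ
  obtain ⟨hUm, -, -⟩ := hUp (𝔇.packetCharH ρ) hαm hαst
  haveI := hF T' hT'
  obtain ⟨C, hCc, hdom⟩ := hUpDom (𝔇.packetCharH ρ) hαst (T' : Set G) (hK T' hT')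
  obtain ⟨B, hB⟩ := hHBH ρ hρ C hCc
  exact memLp_two_of_bound T' (𝔇.μT T') hDGm hUm fun t =>
    norm_mul_up_le_of_upDom 𝔇 P n (𝔇.packetCharH ρ) (T' : Set G) C hdom hB (t : G) t.2

end GenericLB

end Summit.HodgeConjecture.HodgeConjecture.Cruxes.H413.F0P3cStCharTSU2OfUpDom

end
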